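/-
Copyright (c) 2026 the pub-hodgecm-mathlib formalisation cell (harness21).  Prover seat hodgecm-mathlib-K2E3-p14 (g6), Track B "K2-LIT" ∕ h413
(`stmt-HodgeConjecture-24833`), line `K2_E3_EllipticInputs`, road (11-3-split-nsc), leaf (nsc-S-A′) "principal-block standard span", brick E2-R′:
THE `GL₂` JACQUET-EXPONENT MULTIPLICITY DOES NOT SEE THE LABELLING — `mult V (tch ![x,y]) = mult₂ V (maxParabolicLeviChar F 2 x y)`.  2026-09-04.
-/
import Summits.HodgeConjecture.HodgeConjecture.Theorems.K2E3GL2BorelRelabelEquiv      -- ★ E2-R: `standardParabolicGL F id = standardParabolicGL F (lastBlockLabel 2)`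
import Summits.HodgeConjecture.HodgeConjecture.Theorems.K2E3JacquetExponentMultiset   -- ★ E1a: `finrank_weightSpace_eq_of_linearEquiv`
import Literature.NumberTheory.Automorphic.UnipotentRadicalCompactOpenProofs         -- ★ `mem_unipotentRadicalGL_iff_entry`
import HarnessLib

/-!
# K2_E3 road (h413), (11-3-split-nsc) leaf (nsc-S-A′), brick E2-R′ — the `GL₂` Jacquet-exponent multiplicity in the two labellings

Cell `pub/hodgecm-mathlib` (D-0151), Track B, seat K2E3-p14 (g6); requested by the leaf architect K2E3-p25 (g0) (K2 bus 2026-09-04 09:26:32Z (2): "export the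
`mult`-level corollary so G1∕G2 heads plug into E2-J").  CONVENTIONS: the leaf's `id`-currency `mult V χ := finrank ℂ ↥(⨅ m, maxGenEigenspace (normalizedJacquetGL F
(id : Fin 2 → Fin 2) V m) (χ m))` on `LB 2 = Π a : Fin 2, GL {i // id i = a} F` with `tch ![x,y] = ∏ a, (![x,y] a) ∘ det ∘ eval a`, and the G1∕G2 currency
`mult₂ V χ′ := finrank ℂ ↥(⨅ m′, maxGenEigenspace (normalizedJacquetGL F (lastBlockLabel 2) V m′) (χ′ m′))` on `Π b : Bool, GL {i // lastBlockLabel 2 i = b} F` with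
★ `maxParabolicLeviChar F 2 x y` (all INLINE — no definitions).  `--supports stmt-HodgeConjecture-24833 --as helper`; THEOREMS ONLY; COUNT-NEUTRAL.

THE MATHEMATICS ([BernsteinZelevinsky1977, §2.1, §2.3]; [Zelevinsky1980, §1.1, §3.2 Example p. 181]).  The Borel of `GL₂(F)` and its unipotent radical are the same subgroups
whether the two `1 × 1` blocks are labelled by `id : Fin 2 → Fin 2` or by `lastBlockLabel 2 = ![false, true]` (★ E2-R, §1); hence the two Jacquet modules
`V ⁄ ⟨u v − v⟩` are the same quotient of `V` (§2, `Submodule.quotEquivOfEq`), and under the relabelling homomorphism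
`r = proj_id ∘ ι_{lbl} : (Π b : Bool, GL_{1}) →* (Π a : Fin 2, GL_{1})` (surjective, §3) the normalised Levi actions (`δ^{-1∕2}(diag m) · [π(diag m) v]`, same `diag m`,
same `δ`) and the characters (`tch ![x,y] (r m′) = maxParabolicLeviChar F 2 x y m′ = x(m₀₀) y(m₁₁)`) correspond (§3); ★ E1a `finrank_weightSpace_eq_of_linearEquiv` then gives
**`finrank_weightSpace_id_eq_lastBlockLabel_two`**: `mult V (tch ![x,y]) = mult₂ V (maxParabolicLeviChar F 2 x y)` for EVERY representation `V` of `GL₂(F)` (§4).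

HONEST LABEL: HC_CM is proved only modulo the 7 printed citations (2 remaining named inputs: hLiu418 = stmt-HodgeConjecture-24832, h413 =
stmt-HodgeConjecture-24833) until rung 0 closes; count-neutral helper.

## References
* [BernsteinZelevinsky1977] I. N. Bernstein, A. V. Zelevinsky, *Induced representations of reductive 𝔭-adic groups I*, Ann. Sci. ÉNS 10 (1977): §2.1, §2.3.
* [Zelevinsky1980] A. V. Zelevinsky, *Induced representations of reductive 𝔭-adic groups II*, Ann. Sci. ÉNS 13 (1980): §1.1, §3.2.
-/

set_option autoImplicit false
set_option linter.dupNamespace false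

noncomputable section

open scoped MatrixGroups NNReal

namespace Summit.HodgeConjecture.HodgeConjecture.Cruxes.H413.K2E3GL2JacquetRelabel

open Literature.NumberTheory.Automorphic Literature.NumberTheory.Automorphic.Zelevinsky1980
open Literature.NumberTheory.GaloisRepresentations Literature.NumberTheory.GaloisRepresentations.IsNonarchimedeanLocalField

/-! ## §1 The unipotent radical of the Borel of `GL₂` in the two labellings -/

section Subgroups

variable {F : Type*} [Field F]

/-- The unipotent radical of the Borel of `GL₂` is the same subgroup for the labellings `id : Fin 2 → Fin 2` and `lastBlockLabel 2` (upper unitriangular matrices).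
[cite: BernsteinZelevinsky1977, §2.1] -/
theorem unipotentRadicalGL_id_eq_lastBlockLabel_two :
    unipotentRadicalGL F (id : Fin 2 → Fin 2) = unipotentRadicalGL F (lastBlockLabel 2) := by
  refine Subgroup.ext fun g => ?_
  rw [mem_unipotentRadicalGL_iff_entry, mem_unipotentRadicalGL_iff_entry, ← mem_standardParabolicGL_iff, ← mem_standardParabolicGL_iff,
    K2E3GL2BorelRelabelEquiv.standardParabolicGL_id_eq_lastBlockLabel_two]
  refine and_congr_right fun _ => ⟨fun h i j hij => h i j ?_, fun h i j hij => h i j ?_⟩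
  · revert hij
    fin_cases i <;> fin_cases j <;> simp [lastBlockLabel]
  · revert hij
    fin_cases i <;> fin_cases j <;> simp [lastBlockLabel]

/-- A block-diagonal element for `lastBlockLabel 2` lies in the Borel labelled by `id`. [folklore] -/
theorem blockDiagonalGL_lastBlockLabel_mem_id (m' : (Π b : Bool, GL {i : Fin 2 // lastBlockLabel 2 i = b} F)) : blockDiagonalGL F (lastBlockLabel 2) m' ∈ (standardParabolicGL F (id : Fin 2 → Fin 2)) := by
  rw [K2E3GL2BorelRelabelEquiv.standardParabolicGL_id_eq_lastBlockLabel_two]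
  exact blockDiagonalGL_mem _ m'

/-- A block-diagonal element for `id` lies in the Borel labelled by `lastBlockLabel 2`. [folklore] -/
theorem blockDiagonalGL_id_mem_lastBlockLabel (m : (Π a : Fin 2, GL {i : Fin 2 // (id : Fin 2 → Fin 2) i = a} F)) : blockDiagonalGL F (id : Fin 2 → Fin 2) m ∈ (standardParabolicGL F (lastBlockLabel 2)) := by
  rw [← K2E3GL2BorelRelabelEquiv.standardParabolicGL_id_eq_lastBlockLabel_two]
  exact blockDiagonalGL_mem _ m

/-- The off-diagonal entry `(0,1)` of a block-diagonal element (labelling `id`) vanishes. [folklore] -/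
theorem blockDiagonalGL_id_apply_zero_one (m : (Π a : Fin 2, GL {i : Fin 2 // (id : Fin 2 → Fin 2) i = a} F)) :
    ((blockDiagonalGL F (id : Fin 2 → Fin 2) m : GL (Fin 2) F) : Matrix (Fin 2) (Fin 2) F) 0 1 = 0 := by
  rw [blockDiagonalGL_apply_coe_dite, dif_neg (by decide)]

/-- The off-diagonal entry `(0,1)` of a block-diagonal element (labelling `lastBlockLabel 2`) vanishes. [folklore] -/
theorem blockDiagonalGL_lastBlockLabel_apply_zero_one (m' : (Π b : Bool, GL {i : Fin 2 // lastBlockLabel 2 i = b} F)) :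
    ((blockDiagonalGL F (lastBlockLabel 2) m' : GL (Fin 2) F) : Matrix (Fin 2) (Fin 2) F) 0 1 = 0 := by
  rw [blockDiagonalGL_apply_coe_dite, dif_neg (by simp [lastBlockLabel])]

/-- A diagonal element of the Borel (labelling `id`) is the block-diagonal element of its Levi projection. [cite: BernsteinZelevinsky1977, §2.1] -/
theorem coe_leviEmbeddingP_leviProjection_id_two (p : ↥(standardParabolicGL F (id : Fin 2 → Fin 2))) (h01 : ((p : GL (Fin 2) F) : Matrix (Fin 2) (Fin 2) F) 0 1 = 0) :
    ((leviEmbeddingP F (id : Fin 2 → Fin 2) (leviProjection F (id : Fin 2 → Fin 2) p) : ↥(standardParabolicGL F (id : Fin 2 → Fin 2))) : GL (Fin 2) F) = p := by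
  refine Units.ext (Matrix.ext fun i j => ?_)
  rw [coe_leviEmbeddingP, blockDiagonalGL_apply_coe_dite]
  by_cases hij : (id i : Fin 2) = id j
  · rw [dif_pos hij, leviProjection_apply_coe]
  · rw [dif_neg hij]
    fin_cases i <;> fin_cases j
    · exact absurd rfl hij
    · exact h01.symm
    · exact (blockTriangular_of_mem p (show id (0 : Fin 2) < id (1 : Fin 2) by decide)).symm
    · exact absurd rfl hij

/-- A diagonal element of the Borel (labelling `lastBlockLabel 2`) is the block-diagonal element of its Levi projection. [cite: BernsteinZelevinsky1977, §2.1] -/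
theorem coe_leviEmbeddingP_leviProjection_lastBlockLabel_two (p : ↥(standardParabolicGL F (lastBlockLabel 2))) (h01 : ((p : GL (Fin 2) F) : Matrix (Fin 2) (Fin 2) F) 0 1 = 0) :
    ((leviEmbeddingP F (lastBlockLabel 2) (leviProjection F (lastBlockLabel 2) p) : ↥(standardParabolicGL F (lastBlockLabel 2))) : GL (Fin 2) F) = p := by
  refine Units.ext (Matrix.ext fun i j => ?_)
  rw [coe_leviEmbeddingP, blockDiagonalGL_apply_coe_dite]
  by_cases hij : lastBlockLabel 2 i = lastBlockLabel 2 j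
  · rw [dif_pos hij, leviProjection_apply_coe]
  · rw [dif_neg hij]
    fin_cases i <;> fin_cases j
    · exact absurd rfl hij
    · exact h01.symm
    · exact (blockTriangular_of_mem p (show lastBlockLabel 2 (0 : Fin 2) < lastBlockLabel 2 (1 : Fin 2) by simp [lastBlockLabel])).symm
    · exact absurd rfl hij

end Subgroups

/-! ## §2 The two Jacquet modules are the same quotient of `V` -/

section Kernels

variable {R : Type*} [CommRing R] {n : Type*} [Fintype n] [DecidableEq n] {α β : Type*} [LinearOrder α] [LinearOrder β]
  {X : Type*} [AddCommGroup X] [Module ℂ X]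

/-- If `U_{c₁} ≤ U_{c₂}` then `⟨u v − v : u ∈ U_{c₁}⟩ ≤ ⟨u v − v : u ∈ U_{c₂}⟩` in `V`. [cite: BernsteinZelevinsky1977, §2.3] -/
theorem coinvariantsKer_restrictUnipotentGL_mono (c₁ : n → α) (c₂ : n → β) (hle : unipotentRadicalGL R c₁ ≤ unipotentRadicalGL R c₂)
    (π : Representation ℂ (GL n R) X) :
    Representation.Coinvariants.ker (Representation.restrictUnipotentGL R c₁ π) ≤ Representation.Coinvariants.ker (Representation.restrictUnipotentGL R c₂ π) := by
  rw [Representation.Coinvariants.ker, Representation.Coinvariants.ker]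
  refine Submodule.span_le.2 ?_
  rintro _ ⟨⟨u, v⟩, rfl⟩
  obtain ⟨p, hp, hpu⟩ := hle (Subgroup.mem_map.2 ⟨(u : ↥(standardParabolicGL R c₁)), u.2, rfl⟩)
  refine Submodule.subset_span ⟨⟨⟨p, hp⟩, v⟩, ?_⟩
  simp only [Subgroup.coe_subtype] at hpu
  change π (p : GL n R) v - v = π (((u : ↥(standardParabolicGL R c₁))) : GL n R) v - v
  rw [hpu]

/-- **Equal unipotent radicals give the same Jacquet kernel**: if `U_{c₁} = U_{c₂}` as subgroups of `GL_n` then `⟨u v − v⟩_{U_{c₁}} = ⟨u v − v⟩_{U_{c₂}}` in `V`, so the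
two Jacquet modules are the same quotient of `V`. [cite: BernsteinZelevinsky1977, §2.3] -/
theorem coinvariantsKer_restrictUnipotentGL_eq (c₁ : n → α) (c₂ : n → β) (h : unipotentRadicalGL R c₁ = unipotentRadicalGL R c₂)
    (π : Representation ℂ (GL n R) X) :
    Representation.Coinvariants.ker (Representation.restrictUnipotentGL R c₁ π) = Representation.Coinvariants.ker (Representation.restrictUnipotentGL R c₂ π) :=
  le_antisymm (coinvariantsKer_restrictUnipotentGL_mono c₁ c₂ h.le π) (coinvariantsKer_restrictUnipotentGL_mono c₂ c₁ h.ge π)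

end Kernels

/-! ## §3 The relabelling homomorphism `r = proj_id ∘ ι_{lbl}` of the Levi factors -/

section Relabel

variable {F : Type*} [Field F]

/-- **`diag_id (r m′) = diag_{lbl} m′`**: the relabelled Levi element has the same block-diagonal matrix. [cite: BernsteinZelevinsky1977, §2.1] -/
theorem blockDiagonalGL_relabel (m' : (Π b : Bool, GL {i : Fin 2 // lastBlockLabel 2 i = b} F)) :
    blockDiagonalGL F (id : Fin 2 → Fin 2) (((leviProjection F (id : Fin 2 → Fin 2)).comp ((MulEquiv.subgroupCongr (K2E3GL2BorelRelabelEquiv.standardParabolicGL_id_eq_lastBlockLabel_two (F := F)).symm).toMonoidHom.comp (leviEmbeddingP F (lastBlockLabel 2)))) m') = blockDiagonalGL F (lastBlockLabel 2) m' := by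
  have h := coe_leviEmbeddingP_leviProjection_id_two
    (MulEquiv.subgroupCongr (K2E3GL2BorelRelabelEquiv.standardParabolicGL_id_eq_lastBlockLabel_two (F := F)).symm (leviEmbeddingP F (lastBlockLabel 2) m'))
    (by rw [MulEquiv.subgroupCongr_apply, coe_leviEmbeddingP]; exact blockDiagonalGL_lastBlockLabel_apply_zero_one m')
  rw [coe_leviEmbeddingP, MulEquiv.subgroupCongr_apply, coe_leviEmbeddingP] at h
  rw [MonoidHom.coe_comp, Function.comp_apply, MonoidHom.coe_comp, Function.comp_apply, MulEquiv.coe_toMonoidHom]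
  exact h

/-- The Levi embedding of the relabelled element is the original block-diagonal element, as an element of the Borel labelled by `id`. [folklore] -/
theorem leviEmbeddingP_relabel (m' : (Π b : Bool, GL {i : Fin 2 // lastBlockLabel 2 i = b} F)) :
    leviEmbeddingP F (id : Fin 2 → Fin 2) (((leviProjection F (id : Fin 2 → Fin 2)).comp ((MulEquiv.subgroupCongr (K2E3GL2BorelRelabelEquiv.standardParabolicGL_id_eq_lastBlockLabel_two (F := F)).symm).toMonoidHom.comp (leviEmbeddingP F (lastBlockLabel 2)))) m') = MulEquiv.subgroupCongr (K2E3GL2BorelRelabelEquiv.standardParabolicGL_id_eq_lastBlockLabel_two (F := F)).symm (leviEmbeddingP F (lastBlockLabel 2) m') :=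
  Subtype.ext (by rw [coe_leviEmbeddingP, blockDiagonalGL_relabel, MulEquiv.subgroupCongr_apply, coe_leviEmbeddingP])

/-- **`r` is surjective**: `m = r (proj_{lbl} (diag_id m))`. [cite: BernsteinZelevinsky1977, §2.1] -/
theorem relabel_surjective : Function.Surjective ⇑((leviProjection F (id : Fin 2 → Fin 2)).comp ((MulEquiv.subgroupCongr (K2E3GL2BorelRelabelEquiv.standardParabolicGL_id_eq_lastBlockLabel_two (F := F)).symm).toMonoidHom.comp (leviEmbeddingP F (lastBlockLabel 2)))) := by
  intro m
  refine ⟨leviProjection F (lastBlockLabel 2) ⟨blockDiagonalGL F (id : Fin 2 → Fin 2) m, blockDiagonalGL_id_mem_lastBlockLabel m⟩, ?_⟩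
  rw [MonoidHom.coe_comp, Function.comp_apply, MonoidHom.coe_comp, Function.comp_apply, MulEquiv.coe_toMonoidHom]
  have h1 : leviEmbeddingP F (lastBlockLabel 2) (leviProjection F (lastBlockLabel 2)
      ⟨blockDiagonalGL F (id : Fin 2 → Fin 2) m, blockDiagonalGL_id_mem_lastBlockLabel m⟩) =
      ⟨blockDiagonalGL F (id : Fin 2 → Fin 2) m, blockDiagonalGL_id_mem_lastBlockLabel m⟩ :=
    Subtype.ext (coe_leviEmbeddingP_leviProjection_lastBlockLabel_two _ (blockDiagonalGL_id_apply_zero_one m))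
  have h2 : MulEquiv.subgroupCongr (K2E3GL2BorelRelabelEquiv.standardParabolicGL_id_eq_lastBlockLabel_two (F := F)).symm ⟨blockDiagonalGL F (id : Fin 2 → Fin 2) m, blockDiagonalGL_id_mem_lastBlockLabel m⟩ =
      leviEmbeddingP F (id : Fin 2 → Fin 2) m :=
    Subtype.ext rfl
  rw [h1, h2, leviProjection_leviEmbeddingP_apply]

/-- **The characters correspond**: `tch ![x,y] (r m′) = maxParabolicLeviChar F 2 x y m′` (both are `x(m₀₀) · y(m₁₁)`). [cite: Zelevinsky1980, §3.2 Example p. 181] -/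
theorem tch_relabel (x y : Fˣ →* ℂˣ) (m' : (Π b : Bool, GL {i : Fin 2 // lastBlockLabel 2 i = b} F)) : (∏ a : Fin 2, ((![x, y] : Fin 2 → (Fˣ →* ℂˣ)) a).comp (Matrix.GeneralLinearGroup.det.comp (Pi.evalMonoidHom (fun a : Fin 2 => GL {i : Fin 2 // (id : Fin 2 → Fin 2) i = a} F) a))) (((leviProjection F (id : Fin 2 → Fin 2)).comp ((MulEquiv.subgroupCongr (K2E3GL2BorelRelabelEquiv.standardParabolicGL_id_eq_lastBlockLabel_two (F := F)).symm).toMonoidHom.comp (leviEmbeddingP F (lastBlockLabel 2)))) m') = maxParabolicLeviChar F 2 x y m' := by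
  have hu0 : Matrix.GeneralLinearGroup.det (leviProjection F (id : Fin 2 → Fin 2) (MulEquiv.subgroupCongr (K2E3GL2BorelRelabelEquiv.standardParabolicGL_id_eq_lastBlockLabel_two (F := F)).symm (leviEmbeddingP F (lastBlockLabel 2) m')) 0) =
      Matrix.GeneralLinearGroup.det (leviProjection F (lastBlockLabel 2) (leviEmbeddingP F (lastBlockLabel 2) m') false) :=
    Units.ext (by rw [K2E3GL3InductionInStagesEmbedding.det_leviProjection_id_eq_entry, coe_det_leviProjection_lastBlockLabel_two_false]; rfl)
  have hu1 : Matrix.GeneralLinearGroup.det (leviProjection F (id : Fin 2 → Fin 2) (MulEquiv.subgroupCongr (K2E3GL2BorelRelabelEquiv.standardParabolicGL_id_eq_lastBlockLabel_two (F := F)).symm (leviEmbeddingP F (lastBlockLabel 2) m')) 1) =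
      Matrix.GeneralLinearGroup.det (leviProjection F (lastBlockLabel 2) (leviEmbeddingP F (lastBlockLabel 2) m') true) :=
    Units.ext (by rw [K2E3GL3InductionInStagesEmbedding.det_leviProjection_id_eq_entry, coe_det_leviProjection_lastBlockLabel_two_true]; rfl)
  rw [leviProjection_leviEmbeddingP_apply] at hu0 hu1
  rw [MonoidHom.coe_comp, Function.comp_apply, MonoidHom.coe_comp, Function.comp_apply, MulEquiv.coe_toMonoidHom, maxParabolicLeviChar_apply]
  simp only [Fin.prod_univ_two, MonoidHom.mul_apply, MonoidHom.coe_comp, Function.comp_apply, Pi.evalMonoidHom_apply, Matrix.cons_val_zero,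
    Matrix.cons_val_one, hu0, hu1]

variable [ValuativeRel F] [TopologicalSpace F] [IsNonarchimedeanLocalField F]

/-- `δ^{1∕2}` of the Borel of `GL₂` does not see the labelling: `δ_{id}^{1∕2}(g) = δ_{lbl}^{1∕2}(g)` (both `‖g₀₀ ∕ g₁₁‖^{1∕2}`; ★ `coe_rootDeltaChar_standardParabolicGL_fin_two`,
★ `rootDeltaChar_standardParabolicGL_lastBlockLabel`). [cite: BernsteinZelevinsky1977, 1.7] -/
theorem rootDeltaChar_id_eq_lastBlockLabel_two (g : GL (Fin 2) F) (h₁ : g ∈ (standardParabolicGL F (id : Fin 2 → Fin 2))) (h₂ : g ∈ (standardParabolicGL F (lastBlockLabel 2))) :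
    rootDeltaChar (standardParabolicGL F (id : Fin 2 → Fin 2)) ⟨g, h₁⟩ = rootDeltaChar (standardParabolicGL F (lastBlockLabel 2)) ⟨g, h₂⟩ := by
  refine Units.ext ?_
  rw [coe_rootDeltaChar_standardParabolicGL_fin_two, rootDeltaChar_standardParabolicGL_lastBlockLabel F (by norm_num : 1 ≤ 2),
    coe_det_leviProjection_lastBlockLabel_two_false, coe_det_leviProjection_lastBlockLabel_two_true]
  simp [div_eq_mul_inv]

/-- `δ_{id}^{1∕2}(diag_id (r m′)) = δ_{lbl}^{1∕2}(diag_{lbl} m′)`. [cite: BernsteinZelevinsky1977, 1.7] -/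
theorem rootDeltaChar_relabel (m' : (Π b : Bool, GL {i : Fin 2 // lastBlockLabel 2 i = b} F)) :
    rootDeltaChar (standardParabolicGL F (id : Fin 2 → Fin 2)) (leviEmbeddingP F (id : Fin 2 → Fin 2) (((leviProjection F (id : Fin 2 → Fin 2)).comp ((MulEquiv.subgroupCongr (K2E3GL2BorelRelabelEquiv.standardParabolicGL_id_eq_lastBlockLabel_two (F := F)).symm).toMonoidHom.comp (leviEmbeddingP F (lastBlockLabel 2)))) m')) = rootDeltaChar (standardParabolicGL F (lastBlockLabel 2)) (leviEmbeddingP F (lastBlockLabel 2) m') := by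
  rw [leviEmbeddingP_relabel]
  exact rootDeltaChar_id_eq_lastBlockLabel_two _ _ _

end Relabel

/-! ## §4 `mult V (tch ![x,y]) = mult₂ V (maxParabolicLeviChar F 2 x y)` -/

section Main

variable {F : Type*} [Field F] [ValuativeRel F] [TopologicalSpace F] [IsNonarchimedeanLocalField F]

/-- **BRICK E2-R′ — the `GL₂` Jacquet-exponent multiplicity does not see the labelling.**  For EVERY representation `V` of `GL₂(F)` and characters `x, y` of `F^×`,
`finrank ℂ (⨅_m maxGenEigenspace (r^{id}_B V m) (tch ![x,y] m)) = finrank ℂ (⨅_{m′} maxGenEigenspace (r^{lbl}_B V m′) (maxParabolicLeviChar F 2 x y m′))`,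
i.e. `mult V (tch ![x,y]) = mult₂ V (maxParabolicLeviChar F 2 x y)` (leaf `id`-currency = G1∕G2 `lastBlockLabel 2`-currency): the two normalised Jacquet modules are the same
quotient of `V` (§2), the normalised Levi actions and the characters correspond under the surjective relabelling `r` (§3), and ★ E1a `finrank_weightSpace_eq_of_linearEquiv`
transports the multiplicity. [cite: BernsteinZelevinsky1977, §2.3] [cite: Zelevinsky1980, §3.2 Example p. 181] -/
theorem finrank_weightSpace_id_eq_lastBlockLabel_two {X : Type*} [AddCommGroup X] [Module ℂ X] (V : Representation ℂ (GL (Fin 2) F) X) (x y : Fˣ →* ℂˣ) :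
    Module.finrank ℂ ↥(⨅ m, Module.End.maxGenEigenspace ((Representation.normalizedJacquetGL F (id : Fin 2 → Fin 2) V) m) ((((∏ a : Fin 2, ((![x, y] : Fin 2 → (Fˣ →* ℂˣ)) a).comp (Matrix.GeneralLinearGroup.det.comp (Pi.evalMonoidHom (fun a : Fin 2 => GL {i : Fin 2 // (id : Fin 2 → Fin 2) i = a} F) a))) m : ℂˣ) : ℂ))) =
      Module.finrank ℂ ↥(⨅ m', Module.End.maxGenEigenspace ((Representation.normalizedJacquetGL F (lastBlockLabel 2) V) m') ((maxParabolicLeviChar F 2 x y m' : ℂˣ) : ℂ)) := by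
  have hker := coinvariantsKer_restrictUnipotentGL_eq (id : Fin 2 → Fin 2) (lastBlockLabel 2) unipotentRadicalGL_id_eq_lastBlockLabel_two V
  have hiInf : (⨅ m', Module.End.maxGenEigenspace ((Representation.normalizedJacquetGL F (id : Fin 2 → Fin 2) V) (((leviProjection F (id : Fin 2 → Fin 2)).comp ((MulEquiv.subgroupCongr (K2E3GL2BorelRelabelEquiv.standardParabolicGL_id_eq_lastBlockLabel_two (F := F)).symm).toMonoidHom.comp (leviEmbeddingP F (lastBlockLabel 2)))) m')) ((maxParabolicLeviChar F 2 x y m' : ℂˣ) : ℂ)) =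
      ⨅ m, Module.End.maxGenEigenspace ((Representation.normalizedJacquetGL F (id : Fin 2 → Fin 2) V) m) ((((∏ a : Fin 2, ((![x, y] : Fin 2 → (Fˣ →* ℂˣ)) a).comp (Matrix.GeneralLinearGroup.det.comp (Pi.evalMonoidHom (fun a : Fin 2 => GL {i : Fin 2 // (id : Fin 2 → Fin 2) i = a} F) a))) m : ℂˣ) : ℂ)) :=
    Function.Surjective.iInf_congr _ relabel_surjective fun m' => by rw [tch_relabel]
  rw [← hiInf]
  -- the identification of the two Jacquet modules (`[v] ↦ [v]`)
  let Θ : (Representation.restrictUnipotentGL F (id : Fin 2 → Fin 2) V).Coinvariants ≃ₗ[ℂ]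
      (Representation.restrictUnipotentGL F (lastBlockLabel 2) V).Coinvariants := Submodule.quotEquivOfEq _ _ hker
  have hΘ : ∀ z, Θ (Representation.Coinvariants.mk _ z) = Representation.Coinvariants.mk _ z := fun z => Submodule.quotEquivOfEq_mk _ _ hker z
  clear_value Θ
  exact K2E3JacquetExponentMultiset.finrank_weightSpace_eq_of_linearEquiv ((Representation.normalizedJacquetGL F (id : Fin 2 → Fin 2) V).comp ((leviProjection F (id : Fin 2 → Fin 2)).comp ((MulEquiv.subgroupCongr (K2E3GL2BorelRelabelEquiv.standardParabolicGL_id_eq_lastBlockLabel_two (F := F)).symm).toMonoidHom.comp (leviEmbeddingP F (lastBlockLabel 2))))) (Representation.normalizedJacquetGL F (lastBlockLabel 2) V) Θ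
    (fun m' v => by
      obtain ⟨w, rfl⟩ := Representation.Coinvariants.mk_surjective _ v
      rw [MonoidHom.coe_comp, Function.comp_apply, Representation.normalizedJacquetGL_mk, map_smul, hΘ, hΘ, Representation.normalizedJacquetGL_mk,
        blockDiagonalGL_relabel, rootDeltaChar_relabel])
    (fun m' => ((maxParabolicLeviChar F 2 x y m' : ℂˣ) : ℂ))

end Main

end Summit.HodgeConjecture.HodgeConjecture.Cruxes.H413.K2E3GL2JacquetRelabel

end
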